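import Literature.NumberTheory.ComplexMultiplication.CMAlgebraLatticePowersInvertible
import HarnessLib

/-!
# THE BOUND `n − 1` IN DADE–TAUSSKY–ZASSENHAUS'S THEOREM C IS SHARP IN EVERY DIMENSION: Dedekind's lattice
# `L = ⟨1, a, 2a², …, 2a^{n−1}⟩_ℤ` in an order `ℤ[a] = ⊕_{j<n} ℤa^j` of `Y` has `L ⊊ L² ⊊ ⋯ ⊊ L^{n−1} = L^n = ⋯ = ℤ[a]`,
# and `L, L², …, L^{n−2}` are not invertible (HL26 Example 4.7 = [DTZ62], ascribed to Dedekind)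

Topic `Literature/NumberTheory/ComplexMultiplication`, namespace `Literature.NumberTheory.ComplexMultiplication`; lane
`lit-hodgefound` (Track 2 foundations library), Layer A3, seat p19 generation 34, row g34-#3 — companion of g34-#2
(`CMAlgebraLatticeContentFormula`: THEOREM C, `M^k` invertible for every full lattice `M` and every `k ≥ n − 1`) and
g33-#1 (`CMAlgebraLatticePowersInvertible`: HL26 Lemma 4.6, the powers below the stationary one are not invertible).
THEOREMS ONLY: no definition, no instance, no named fact (D-0026, net Literature debt `0`), no `sorry`.

## Source, VERBATIM

C. Hertling, K. Larabi, *Conjugacy classes of regular integer matrices*, arXiv:2602.15748 (2026) (= [HL26], the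
companion of [HertlingLarabi2026]), held `paper:arxiv-2602.15748`, §4 chunk p0007: «**Lemma 4.6.** Let `Λ` be an
order, and let `L` be a full lattice which is not an order, but which satisfies `1_A ∈ L` and `L ⊂ Λ`. Then there is
a unique `l ∈ ℤ_{≥2}` with `L ⊊ L² ⊊ ⋯ ⊊ L^l = L^{l+k} ⊂ Λ` for `k ≥ 1`. `L^l` is an order with `L·L^l = L^l`. The full
lattices `L, L², …, L^{l−1}` are not invertible. […] **Example 4.7** (DTZ62). Let `dim A = n ≥ 3` and suppose that
`Λ = ℤ[a] ⊂ A` is an order. Define `L := ⟨1, a, 2a², ..., 2a^{n−1}⟩_ℤ ⊂ Λ`. Then `L² = ⟨1_A, a, a², 2a³, ..., 2a^{n−1}⟩_ℤ`,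
`L³ = ⟨1_A, a, a², a³, 2a⁴, ..., 2a^{n−1}⟩_ℤ`, ⋯, `L^{n−1} = ⟨1_A, a, a², ..., a^{n−1}⟩_ℤ = Λ`,
`L ⊊ L² ⊊ L³ ⊊ ... ⊊ L^{n−1} = L^n = ... = Λ`, and `L, L², ..., L^{n−2}` are not invertible by Lemma 4.6.»
([HertlingLarabi2026] §10, chunk p0026, on the same example: [DTZ62] «ascribes the example and the observation to
Dedekind».)

## What is proved

For `Y = ∏ᵢ Lᵢ` (number fields `Lᵢ`), `n = finrank ℚ Y ≥ 3`, an element `a ∈ Y` such that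
`Λ := ⟨1, a, …, a^{n−1}⟩_ℤ` is a full lattice closed under multiplication (HL's «suppose that `Λ = ℤ[a] ⊂ A` is an
order»), and the lattices `M_k := ⟨c_{k,j}a^j : j < n⟩_ℤ`, `c_{k,j} = 1` for `j ≤ k`, `= 2` for `j > k` (so `L = M_1`,
`M_k = Λ` for `k ≥ n − 1`), all written as `Submodule.span ℤ (Set.range …)`:
* `span_smulPow_mul_span_smulPow_one` — `M_k·M_1 = M_{k+1}` (`k ≥ 1`), hence `pow_span_smulPow_one_eq` — `L^k = M_k`
  for `k ≥ 1` (the displayed list of powers), `pow_span_smulPow_one_eq_order` — `L^k = Λ` for `k ≥ n − 1`;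
* `pow_mem_span_smulPow_iff` ∕ `span_smulPow_ne` — `a^{k+1} ∉ M_k` for `k + 1 < n`, so `L ⊊ L² ⊊ ⋯ ⊊ L^{n−1}`
  (`pow_span_smulPow_one_ssubset`);
* **`pow_span_smulPow_one_mul_div_div_ne` — `L^j` is NOT invertible for `1 ≤ j ≤ n − 2`** (by the tree's HL26
  Lemma 4.6, `pow_mul_div_div_ne_of_ne_pow`), while `L^{n−1} = Λ` is (an order); packaged with Theorem C's bound as
  **`exists_isFullLattice_pow_not_invertible`: the exponent `n − 1` of DTZ62 Theorem C cannot be lowered** whenever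
  `Y` contains such an `a`.
NOT here: the existence of a monogenic order `ℤ[a]` in a given `Y` (for a number field any primitive algebraic
integer; for `∏ Lᵢ` primitive integers with pairwise coprime minimal polynomials).

## References
* [HertlingLarabi2026] companion paper: C. Hertling, K. Larabi, *Conjugacy classes of regular integer matrices*,
  arXiv:2602.15748 (2026), §4 Lemma 4.6, Example 4.7 (chunk p0007); and arXiv:2602.14973 §10 (chunk p0026).
  [cite: HertlingLarabi2026, companion paper arXiv:2602.15748 §4 Example 4.7 and Lemma 4.6, chunk p0007]
* [DadeTausskyZassenhaus1962] E. C. Dade, O. Taussky, H. Zassenhaus, Math. Ann. 148 (1962) 31–64 (the example, ascribed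
  to Dedekind; as cited by HL26 Example 4.7; not held). [cite: DadeTausskyZassenhaus1962, §1.5 (example after Theorem C, as cited by HL26 Ex. 4.7)]
-/

noncomputable section

open scoped Classical Pointwise nonZeroDivisors NumberField
open Module NumberField Function Submodule

namespace Literature.NumberTheory.ComplexMultiplication

open Literature.NumberTheory.Automorphic

section DedekindExample

variable {t : Type} {L : t → Type} [∀ i, Field (L i)] [∀ i, NumberField (L i)]

/-! ## §1 The lattices `M_k = ⟨c_{k,j}a^j⟩`, `c_{k,j} ∈ {1, 2}` -/

omit [∀ i, NumberField (L i)] in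
/-- `M_k ⊆ M_{k'}` for `k ≤ k'` (coefficient conditions weaken). [cite: HertlingLarabi2026, companion paper arXiv:2602.15748 §4 Example 4.7, chunk p0007] -/
theorem span_smulPow_mono (a : Π i, L i) {n k k' : ℕ} (hkk' : k ≤ k') :
    span ℤ (Set.range fun j : Fin n => (if (j : ℕ) ≤ k then (1 : ℤ) else 2) • a ^ (j : ℕ)) ≤
      span ℤ (Set.range fun j : Fin n => (if (j : ℕ) ≤ k' then (1 : ℤ) else 2) • a ^ (j : ℕ)) := by
  rw [span_le]
  rintro _ ⟨j, rfl⟩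
  by_cases hj : (j : ℕ) ≤ k
  · have hj' : (j : ℕ) ≤ k' := hj.trans hkk'
    simp only [hj, if_true]
    exact subset_span ⟨j, by simp only [hj', if_true]⟩
  · by_cases hj' : (j : ℕ) ≤ k'
    · simp only [hj, if_false]
      have h := subset_span (R := ℤ) (s := Set.range fun j : Fin n => (if (j : ℕ) ≤ k' then (1 : ℤ) else 2) • a ^ (j : ℕ))
        ⟨j, rfl⟩
      simp only [hj', if_true, one_smul] at h
      exact smul_mem _ _ h
    · simp only [hj, if_false]
      exact subset_span ⟨j, by simp only [hj', if_false]⟩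

omit [∀ i, NumberField (L i)] in
/-- `2a^j ∈ M_k` for every `j < n`. [cite: HertlingLarabi2026, companion paper arXiv:2602.15748 §4 Example 4.7, chunk p0007] -/
theorem two_smul_pow_mem_span_smulPow (a : Π i, L i) {n : ℕ} (k : ℕ) (j : Fin n) :
    (2 : ℤ) • a ^ (j : ℕ) ∈ span ℤ (Set.range fun j : Fin n => (if (j : ℕ) ≤ k then (1 : ℤ) else 2) • a ^ (j : ℕ)) := by
  by_cases hj : (j : ℕ) ≤ k
  · have h := subset_span (R := ℤ) (s := Set.range fun j : Fin n => (if (j : ℕ) ≤ k then (1 : ℤ) else 2) • a ^ (j : ℕ))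
      ⟨j, rfl⟩
    simp only [hj, if_true, one_smul] at h
    exact smul_mem _ _ h
  · exact subset_span ⟨j, by simp only [hj, if_false]⟩

omit [∀ i, NumberField (L i)] in
/-- `M_k ⊆ Λ = ⟨a^j⟩`. [cite: HertlingLarabi2026, companion paper arXiv:2602.15748 §4 Example 4.7 («`⊂ Λ`»), chunk p0007] -/
theorem span_smulPow_le_span_pow (a : Π i, L i) {n : ℕ} (k : ℕ) :
    span ℤ (Set.range fun j : Fin n => (if (j : ℕ) ≤ k then (1 : ℤ) else 2) • a ^ (j : ℕ)) ≤
      span ℤ (Set.range fun j : Fin n => a ^ (j : ℕ)) := by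
  rw [span_le]
  rintro _ ⟨j, rfl⟩
  exact smul_mem _ _ (subset_span ⟨j, rfl⟩)

omit [∀ i, NumberField (L i)] in
/-- For `k ≥ n − 1` all coefficients are `1`: `M_k = Λ`. [cite: HertlingLarabi2026, companion paper arXiv:2602.15748 §4 Example 4.7 («`L^{n−1} = ⟨1_A, a, …, a^{n−1}⟩_ℤ = Λ`»), chunk p0007] -/
theorem span_smulPow_eq_span_pow (a : Π i, L i) {n k : ℕ} (hk : n - 1 ≤ k) :
    span ℤ (Set.range fun j : Fin n => (if (j : ℕ) ≤ k then (1 : ℤ) else 2) • a ^ (j : ℕ)) =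
      span ℤ (Set.range fun j : Fin n => a ^ (j : ℕ)) := by
  have hfun : (fun j : Fin n => (if (j : ℕ) ≤ k then (1 : ℤ) else 2) • a ^ (j : ℕ)) = fun j : Fin n => a ^ (j : ℕ) := by
    funext j
    rw [if_pos (by omega), one_smul]
  rw [hfun]

omit [∀ i, NumberField (L i)] in
/-- `2Λ ⊆ M_k`. [cite: HertlingLarabi2026, companion paper arXiv:2602.15748 §4 Example 4.7, chunk p0007] -/
theorem two_smul_mem_span_smulPow (a : Π i, L i) {n : ℕ} (k : ℕ) {x : Π i, L i}
    (hx : x ∈ span ℤ (Set.range fun j : Fin n => a ^ (j : ℕ))) :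
    (2 : ℤ) • x ∈ span ℤ (Set.range fun j : Fin n => (if (j : ℕ) ≤ k then (1 : ℤ) else 2) • a ^ (j : ℕ)) := by
  refine span_induction (fun y hy => ?_) (by rw [smul_zero]; exact zero_mem _)
    (fun y z _ _ hy hz => by rw [smul_add]; exact add_mem hy hz)
    (fun m y _ hy => by rw [smul_comm]; exact smul_mem _ _ hy) hx
  obtain ⟨j, rfl⟩ := hy
  exact two_smul_pow_mem_span_smulPow a k j

omit [∀ i, NumberField (L i)] in
/-- In an order `Λ = ⟨1, a, …, a^{n−1}⟩` (`ΛΛ ⊆ Λ`, `n ≥ 2`) all powers of `a` lie in `Λ`. [cite: HertlingLarabi2026, companion paper arXiv:2602.15748 §4 Example 4.7 («`Λ = ℤ[a]` is an order»), chunk p0007] -/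
theorem pow_mem_span_pow (a : Π i, L i) {n : ℕ} (hn : 2 ≤ n)
    (hmul : span ℤ (Set.range fun j : Fin n => a ^ (j : ℕ)) * span ℤ (Set.range fun j : Fin n => a ^ (j : ℕ)) ≤
      span ℤ (Set.range fun j : Fin n => a ^ (j : ℕ))) (m : ℕ) :
    a ^ m ∈ span ℤ (Set.range fun j : Fin n => a ^ (j : ℕ)) := by
  induction m with
  | zero => exact subset_span ⟨⟨0, by omega⟩, by simp⟩
  | succ m ih =>
    rw [pow_succ]
    exact hmul (mul_mem_mul ih (subset_span ⟨⟨1, by omega⟩, by simp⟩))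


omit [∀ i, NumberField (L i)] in
/-- `a^j ∈ M_k` for `j ≤ k`, `j < n`. [cite: HertlingLarabi2026, companion paper arXiv:2602.15748 §4 Example 4.7, chunk p0007] -/
theorem pow_mem_span_smulPow_of_le (a : Π i, L i) {n k : ℕ} (j : Fin n) (hj : (j : ℕ) ≤ k) :
    a ^ (j : ℕ) ∈ span ℤ (Set.range fun j : Fin n => (if (j : ℕ) ≤ k then (1 : ℤ) else 2) • a ^ (j : ℕ)) :=
  subset_span ⟨j, by simp only [hj, if_true, one_smul]⟩

/-! ## §2 The powers of `L = M_1`: `L^k = M_k` -/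

omit [∀ i, NumberField (L i)] in
/-- **`M_k·M_1 = M_{k+1}`** (`k ≥ 1`, `n ≥ 2`; `2Λ ⊆ M_{k+1}` absorbs every product with an even coefficient, and `a^n ∈ Λ`
only occurs when `M_{k+1} = Λ`). [cite: HertlingLarabi2026, companion paper arXiv:2602.15748 §4 Example 4.7 (the displayed powers), chunk p0007] -/
theorem span_smulPow_mul_span_smulPow_one (a : Π i, L i) {n : ℕ} (hn : 2 ≤ n)
    (hmul : span ℤ (Set.range fun j : Fin n => a ^ (j : ℕ)) * span ℤ (Set.range fun j : Fin n => a ^ (j : ℕ)) ≤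
      span ℤ (Set.range fun j : Fin n => a ^ (j : ℕ))) {k : ℕ} (hk : 1 ≤ k) :
    span ℤ (Set.range fun j : Fin n => (if (j : ℕ) ≤ k then (1 : ℤ) else 2) • a ^ (j : ℕ)) *
        span ℤ (Set.range fun j : Fin n => (if (j : ℕ) ≤ 1 then (1 : ℤ) else 2) • a ^ (j : ℕ)) =
      span ℤ (Set.range fun j : Fin n => (if (j : ℕ) ≤ k + 1 then (1 : ℤ) else 2) • a ^ (j : ℕ)) := by
  have hΛ := pow_mem_span_pow a hn hmul
  apply le_antisymm
  · rw [span_mul_span, span_le]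
    rintro _ ⟨_, ⟨i, rfl⟩, _, ⟨j, rfl⟩, rfl⟩
    simp only [SetLike.mem_coe]
    rw [smul_mul_smul_comm, ← pow_add]
    by_cases hi : (i : ℕ) ≤ k
    · by_cases hj1 : (j : ℕ) ≤ 1
      · -- coefficient `1·1`: the power `a^{i+j}` with `i + j ≤ k + 1`
        simp only [hi, hj1, if_true, one_mul, one_smul]
        by_cases hlt : (i : ℕ) + j < n
        · exact pow_mem_span_smulPow_of_le a ⟨(i : ℕ) + j, hlt⟩ (by simp only; omega)
        · rw [span_smulPow_eq_span_pow a (by omega)]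
          exact hΛ _
      · simp only [hi, hj1, if_true, if_false, one_mul]
        exact two_smul_mem_span_smulPow a _ (hΛ _)
    · by_cases hj1 : (j : ℕ) ≤ 1
      · simp only [hi, hj1, if_true, if_false, mul_one]
        exact two_smul_mem_span_smulPow a _ (hΛ _)
      · simp only [hi, hj1, if_false]
        rw [show ((2 : ℤ) * 2) = 2 * 2 from rfl, mul_smul]
        exact smul_mem _ _ (two_smul_mem_span_smulPow a _ (hΛ _))
  · rw [span_le]
    rintro _ ⟨j, rfl⟩
    simp only [SetLike.mem_coe]
    have ha1 : a ∈ span ℤ (Set.range fun j : Fin n => (if (j : ℕ) ≤ 1 then (1 : ℤ) else 2) • a ^ (j : ℕ)) := by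
      have h := pow_mem_span_smulPow_of_le (k := 1) a (⟨1, by omega⟩ : Fin n) le_rfl
      rwa [pow_one] at h
    by_cases hj : (j : ℕ) ≤ k + 1
    · simp only [hj, if_true, one_smul]
      rcases Nat.eq_zero_or_pos (j : ℕ) with h0 | hpos
      · -- `1 = 1·1`
        rw [h0, pow_zero, ← one_mul (1 : Π i, L i)]
        refine mul_mem_mul ?_ ?_
        · have h := pow_mem_span_smulPow_of_le (k := k) a (⟨0, by omega⟩ : Fin n) (Nat.zero_le _)
          rwa [pow_zero] at h
        · have h := pow_mem_span_smulPow_of_le (k := 1) a (⟨0, by omega⟩ : Fin n) (Nat.zero_le _)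
          rwa [pow_zero] at h
      · -- `a^j = a^{j-1}·a`
        rw [show (j : ℕ) = ((j : ℕ) - 1) + 1 by omega, pow_succ]
        exact mul_mem_mul (pow_mem_span_smulPow_of_le a ⟨(j : ℕ) - 1, by omega⟩ (by simp only; omega)) ha1
    · -- `2a^j = (2a^{j-1})·a`
      simp only [hj, if_false]
      rw [show (j : ℕ) = ((j : ℕ) - 1) + 1 by omega, pow_succ, ← smul_mul_assoc]
      exact mul_mem_mul (two_smul_pow_mem_span_smulPow a k ⟨(j : ℕ) - 1, by omega⟩) ha1

omit [∀ i, NumberField (L i)] in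
/-- **THE POWERS OF DEDEKIND'S LATTICE: `L^k = M_k = ⟨1, a, …, a^k, 2a^{k+1}, …, 2a^{n−1}⟩` for `k ≥ 1`**, `L = M_1 =
⟨1, a, 2a², …, 2a^{n−1}⟩`. [cite: HertlingLarabi2026, companion paper arXiv:2602.15748 §4 Example 4.7, chunk p0007] -/
theorem pow_span_smulPow_one_eq (a : Π i, L i) {n : ℕ} (hn : 2 ≤ n)
    (hmul : span ℤ (Set.range fun j : Fin n => a ^ (j : ℕ)) * span ℤ (Set.range fun j : Fin n => a ^ (j : ℕ)) ≤
      span ℤ (Set.range fun j : Fin n => a ^ (j : ℕ))) {k : ℕ} (hk : 1 ≤ k) :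
    span ℤ (Set.range fun j : Fin n => (if (j : ℕ) ≤ 1 then (1 : ℤ) else 2) • a ^ (j : ℕ)) ^ k =
      span ℤ (Set.range fun j : Fin n => (if (j : ℕ) ≤ k then (1 : ℤ) else 2) • a ^ (j : ℕ)) := by
  induction k, hk using Nat.le_induction with
  | base => rw [pow_one]
  | succ k hk ih => rw [pow_succ, ih, span_smulPow_mul_span_smulPow_one a hn hmul hk]

omit [∀ i, NumberField (L i)] in
/-- **`L^k = Λ = ℤ[a]` for every `k ≥ n − 1`** («`L^{n−1} = L^n = ... = Λ`»). [cite: HertlingLarabi2026, companion paper arXiv:2602.15748 §4 Example 4.7, chunk p0007] -/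
theorem pow_span_smulPow_one_eq_span_pow (a : Π i, L i) {n : ℕ} (hn : 2 ≤ n)
    (hmul : span ℤ (Set.range fun j : Fin n => a ^ (j : ℕ)) * span ℤ (Set.range fun j : Fin n => a ^ (j : ℕ)) ≤
      span ℤ (Set.range fun j : Fin n => a ^ (j : ℕ))) {k : ℕ} (hk : n - 1 ≤ k) :
    span ℤ (Set.range fun j : Fin n => (if (j : ℕ) ≤ 1 then (1 : ℤ) else 2) • a ^ (j : ℕ)) ^ k =
      span ℤ (Set.range fun j : Fin n => a ^ (j : ℕ)) := by
  rw [pow_span_smulPow_one_eq a hn hmul (by omega), span_smulPow_eq_span_pow a hk]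

/-! ## §3 Strictness `L ⊊ L² ⊊ ⋯ ⊊ L^{n−1}` and non-invertibility of `L, …, L^{n−2}` -/

/-- The powers `1, a, …, a^{n−1}` spanning a full lattice are `ℤ`-linearly independent (`n = dim_ℚ Y`).
[cite: HertlingLarabi2026, §2 Def. 2.1 (a), Lemma 2.2 (a), chunk p0005] -/
theorem linearIndependent_pow_of_isFullLattice (a : Π i, L i)
    (hfull : IsFullLattice (Π i, L i) (span ℤ (Set.range fun j : Fin (finrank ℚ (Π i, L i)) => a ^ (j : ℕ)))) :
    LinearIndependent ℤ (fun j : Fin (finrank ℚ (Π i, L i)) => a ^ (j : ℕ)) := by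
  have hQ : LinearIndependent ℚ (fun j : Fin (finrank ℚ (Π i, L i)) => a ^ (j : ℕ)) := by
    refine linearIndependent_of_top_le_span_of_card_eq_finrank (fun y _ => ?_) (Fintype.card_fin _)
    obtain ⟨m, hm, hmy⟩ := hfull.2 y
    have hy : y = (m : ℚ)⁻¹ • ((m : ℤ) • y) := by
      rw [← Int.cast_smul_eq_zsmul ℚ, smul_smul, inv_mul_cancel₀ (by exact_mod_cast hm), one_smul]
    rw [hy]
    exact smul_mem _ _ (span_subset_span ℤ ℚ _ hmy)
  exact hQ.restrict_scalars' ℤ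

/-- **`a^{k+1} ∉ M_k` for `k + 1 < n`** (its coefficient on the `ℤ`-basis `(a^j)` would be twice an integer): so
`M_k ⊊ M_{k+1}`, i.e. `L^k ⊊ L^{k+1}` for `1 ≤ k ≤ n − 2`. [cite: HertlingLarabi2026, companion paper arXiv:2602.15748 §4 Example 4.7 («`L ⊊ L² ⊊ L³ ⊊ ... ⊊ L^{n−1}`»), chunk p0007] -/
theorem pow_succ_not_mem_span_smulPow (a : Π i, L i)
    (hfull : IsFullLattice (Π i, L i) (span ℤ (Set.range fun j : Fin (finrank ℚ (Π i, L i)) => a ^ (j : ℕ))))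
    {k : ℕ} (hk : k + 1 < finrank ℚ (Π i, L i)) :
    a ^ (k + 1) ∉ span ℤ (Set.range fun j : Fin (finrank ℚ (Π i, L i)) =>
      (if (j : ℕ) ≤ k then (1 : ℤ) else 2) • a ^ (j : ℕ)) := by
  intro hmem
  obtain ⟨m, hm⟩ := (mem_span_range_iff_exists_fun ℤ).1 hmem
  have hli := linearIndependent_pow_of_isFullLattice a hfull
  -- compare coefficients of `a^{k+1}`
  set j₀ : Fin (finrank ℚ (Π i, L i)) := ⟨k + 1, hk⟩ with hj₀
  have hrel : ∑ j : Fin (finrank ℚ (Π i, L i)),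
      (m j * (if (j : ℕ) ≤ k then (1 : ℤ) else 2) - if j = j₀ then 1 else 0) • a ^ (j : ℕ) = 0 := by
    calc ∑ j : Fin (finrank ℚ (Π i, L i)),
          (m j * (if (j : ℕ) ≤ k then (1 : ℤ) else 2) - if j = j₀ then 1 else 0) • a ^ (j : ℕ)
        = ∑ j : Fin (finrank ℚ (Π i, L i)), (m j * (if (j : ℕ) ≤ k then (1 : ℤ) else 2)) • a ^ (j : ℕ) -
            ∑ j : Fin (finrank ℚ (Π i, L i)), (if j = j₀ then (1 : ℤ) else 0) • a ^ (j : ℕ) := by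
          simp only [sub_smul, Finset.sum_sub_distrib]
      _ = a ^ (k + 1) - a ^ (k + 1) := by
          congr 1
          · rw [← hm]
            exact Finset.sum_congr rfl fun j _ => mul_smul _ _ _
          · rw [Finset.sum_eq_single j₀ (fun j _ hj => by rw [if_neg hj, zero_smul])
              (fun h => absurd (Finset.mem_univ _) h), if_pos rfl, one_smul]
      _ = 0 := sub_self _
  have h0 := Fintype.linearIndependent_iff.1 hli _ hrel j₀
  rw [if_pos rfl, hj₀, if_neg (show ¬ (k + 1 ≤ k) from Nat.not_succ_le_self k)] at h0
  omega

/-- **Dedekind's chain is strict: `L^k ≠ L^{k+1}` for `1 ≤ k ≤ n − 2`.** [cite: HertlingLarabi2026, companion paper arXiv:2602.15748 §4 Example 4.7, chunk p0007] -/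
theorem pow_span_smulPow_one_ne_pow_succ (a : Π i, L i)
    (hfull : IsFullLattice (Π i, L i) (span ℤ (Set.range fun j : Fin (finrank ℚ (Π i, L i)) => a ^ (j : ℕ))))
    (hmul : span ℤ (Set.range fun j : Fin (finrank ℚ (Π i, L i)) => a ^ (j : ℕ)) *
        span ℤ (Set.range fun j : Fin (finrank ℚ (Π i, L i)) => a ^ (j : ℕ)) ≤
      span ℤ (Set.range fun j : Fin (finrank ℚ (Π i, L i)) => a ^ (j : ℕ)))
    {k : ℕ} (hk1 : 1 ≤ k) (hk : k + 1 < finrank ℚ (Π i, L i)) :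
    span ℤ (Set.range fun j : Fin (finrank ℚ (Π i, L i)) => (if (j : ℕ) ≤ 1 then (1 : ℤ) else 2) • a ^ (j : ℕ)) ^ k ≠
      span ℤ (Set.range fun j : Fin (finrank ℚ (Π i, L i)) => (if (j : ℕ) ≤ 1 then (1 : ℤ) else 2) • a ^ (j : ℕ)) ^ (k + 1) := by
  rw [pow_span_smulPow_one_eq a (by omega) hmul hk1, pow_span_smulPow_one_eq a (by omega) hmul (by omega)]
  intro h
  exact pow_succ_not_mem_span_smulPow a hfull hk (h.symm ▸ pow_mem_span_smulPow_of_le a ⟨k + 1, hk⟩ le_rfl)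

omit [∀ i, NumberField (L i)] in
/-- Dedekind's `L` is a full lattice (it contains `2Λ`). [cite: HertlingLarabi2026, companion paper arXiv:2602.15748 §4 Example 4.7, chunk p0007] -/
theorem isFullLattice_span_smulPow (a : Π i, L i) {n : ℕ}
    (hfull : IsFullLattice (Π i, L i) (span ℤ (Set.range fun j : Fin n => a ^ (j : ℕ)))) (k : ℕ) :
    IsFullLattice (Π i, L i) (span ℤ (Set.range fun j : Fin n => (if (j : ℕ) ≤ k then (1 : ℤ) else 2) • a ^ (j : ℕ))) := by
  refine ⟨fg_span (Set.finite_range _), fun y => ?_⟩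
  obtain ⟨m, hm, hmy⟩ := hfull.2 y
  exact ⟨2 * m, mul_ne_zero two_ne_zero hm, by rw [mul_smul]; exact two_smul_mem_span_smulPow a k hmy⟩

/-- **HL26 EXAMPLE 4.7 ∕ [DTZ62] (Dedekind): the powers `L, L², …, L^{n−2}` of `L = ⟨1, a, 2a², …, 2a^{n−1}⟩` are NOT
invertible**, `n = dim_ℚ Y ≥ 3`, `ℤ[a] = ⟨1, a, …, a^{n−1}⟩` a full lattice closed under multiplication («and `L`, `L²`,
..., `L^{n−2}` are not invertible by Lemma 4.6» — the tree's `pow_mul_div_div_ne_of_ne_pow`).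
[cite: HertlingLarabi2026, companion paper arXiv:2602.15748 §4 Example 4.7 and Lemma 4.6, chunk p0007]
[cite: DadeTausskyZassenhaus1962, §1.5 (example after Theorem C, as cited by HL26 Ex. 4.7)] -/
theorem pow_span_smulPow_one_mul_div_div_ne (a : Π i, L i)
    (hfull : IsFullLattice (Π i, L i) (span ℤ (Set.range fun j : Fin (finrank ℚ (Π i, L i)) => a ^ (j : ℕ))))
    (hmul : span ℤ (Set.range fun j : Fin (finrank ℚ (Π i, L i)) => a ^ (j : ℕ)) *
        span ℤ (Set.range fun j : Fin (finrank ℚ (Π i, L i)) => a ^ (j : ℕ)) ≤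
      span ℤ (Set.range fun j : Fin (finrank ℚ (Π i, L i)) => a ^ (j : ℕ)))
    {k : ℕ} (hk1 : 1 ≤ k) (hk : k + 2 ≤ finrank ℚ (Π i, L i)) :
    span ℤ (Set.range fun j : Fin (finrank ℚ (Π i, L i)) => (if (j : ℕ) ≤ 1 then (1 : ℤ) else 2) • a ^ (j : ℕ)) ^ k *
        ((span ℤ (Set.range fun j : Fin (finrank ℚ (Π i, L i)) => (if (j : ℕ) ≤ 1 then (1 : ℤ) else 2) • a ^ (j : ℕ)) ^ k /
            span ℤ (Set.range fun j : Fin (finrank ℚ (Π i, L i)) => (if (j : ℕ) ≤ 1 then (1 : ℤ) else 2) • a ^ (j : ℕ)) ^ k) /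
          span ℤ (Set.range fun j : Fin (finrank ℚ (Π i, L i)) => (if (j : ℕ) ≤ 1 then (1 : ℤ) else 2) • a ^ (j : ℕ)) ^ k) ≠
      span ℤ (Set.range fun j : Fin (finrank ℚ (Π i, L i)) => (if (j : ℕ) ≤ 1 then (1 : ℤ) else 2) • a ^ (j : ℕ)) ^ k /
        span ℤ (Set.range fun j : Fin (finrank ℚ (Π i, L i)) => (if (j : ℕ) ≤ 1 then (1 : ℤ) else 2) • a ^ (j : ℕ)) ^ k := by
  set n := finrank ℚ (Π i, L i) with hn
  have h1 : (1 : Π i, L i) ∈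
      span ℤ (Set.range fun j : Fin n => (if (j : ℕ) ≤ 1 then (1 : ℤ) else 2) • a ^ (j : ℕ)) := by
    have h := pow_mem_span_smulPow_of_le (k := 1) a (⟨0, by omega⟩ : Fin n) (Nat.zero_le _)
    rwa [pow_zero] at h
  -- stationary from `N = n - 1` on
  have hstab : ∀ l : ℕ,
      span ℤ (Set.range fun j : Fin n => (if (j : ℕ) ≤ 1 then (1 : ℤ) else 2) • a ^ (j : ℕ)) ^ (n - 1 + l) =
        span ℤ (Set.range fun j : Fin n => (if (j : ℕ) ≤ 1 then (1 : ℤ) else 2) • a ^ (j : ℕ)) ^ (n - 1) := fun l => by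
    rw [pow_span_smulPow_one_eq_span_pow a (by omega) hmul le_rfl,
      pow_span_smulPow_one_eq_span_pow a (by omega) hmul (Nat.le_add_right _ _)]
  refine pow_mul_div_div_ne_of_ne_pow (isFullLattice_span_smulPow a hfull 1) h1 hstab hk1 ?_
  -- `L^k ≠ L^{n-1} = Λ` since `a^{k+1} ∉ L^k = M_k`
  rw [pow_span_smulPow_one_eq a (by omega) hmul hk1, pow_span_smulPow_one_eq_span_pow a (by omega) hmul le_rfl]
  intro h
  have hmem : a ^ (k + 1) ∈ span ℤ (Set.range fun j : Fin n => a ^ (j : ℕ)) := subset_span ⟨⟨k + 1, by omega⟩, rfl⟩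
  rw [← h] at hmem
  exact pow_succ_not_mem_span_smulPow a hfull hk hmem

/-- **THE EXPONENT `n − 1` OF DTZ62 THEOREM C IS SHARP: if `Y` (`n = dim_ℚ Y ≥ 3`) contains a monogenic order
`ℤ[a] = ⟨1, a, …, a^{n−1}⟩_ℤ`, there is a full lattice `L` with `1 ∈ L ⊆ ℤ[a]`, `L^k = ℤ[a]` for all `k ≥ n − 1`, and
`L^k` NOT invertible for every `1 ≤ k ≤ n − 2`** — Dedekind's `L = ⟨1, a, 2a², …, 2a^{n−1}⟩`.
[cite: HertlingLarabi2026, companion paper arXiv:2602.15748 §4 Example 4.7, chunk p0007] [cite: DadeTausskyZassenhaus1962, §1.5 (example after Theorem C, as cited by HL26 Ex. 4.7)] -/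
theorem exists_isFullLattice_pow_not_invertible (a : Π i, L i)
    (hfull : IsFullLattice (Π i, L i) (span ℤ (Set.range fun j : Fin (finrank ℚ (Π i, L i)) => a ^ (j : ℕ))))
    (hmul : span ℤ (Set.range fun j : Fin (finrank ℚ (Π i, L i)) => a ^ (j : ℕ)) *
        span ℤ (Set.range fun j : Fin (finrank ℚ (Π i, L i)) => a ^ (j : ℕ)) ≤
      span ℤ (Set.range fun j : Fin (finrank ℚ (Π i, L i)) => a ^ (j : ℕ)))
    (hn : 3 ≤ finrank ℚ (Π i, L i)) :
    ∃ M : Submodule ℤ (Π i, L i), IsFullLattice (Π i, L i) M ∧ (1 : Π i, L i) ∈ M ∧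
      M ≤ span ℤ (Set.range fun j : Fin (finrank ℚ (Π i, L i)) => a ^ (j : ℕ)) ∧
      (∀ k : ℕ, finrank ℚ (Π i, L i) - 1 ≤ k →
        M ^ k = span ℤ (Set.range fun j : Fin (finrank ℚ (Π i, L i)) => a ^ (j : ℕ))) ∧
      (∀ k : ℕ, 1 ≤ k → k + 2 ≤ finrank ℚ (Π i, L i) → M ^ k * ((M ^ k / M ^ k) / M ^ k) ≠ M ^ k / M ^ k) ∧
      ∀ k : ℕ, 1 ≤ k → k + 1 < finrank ℚ (Π i, L i) → M ^ k ≠ M ^ (k + 1) := by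
  refine ⟨span ℤ (Set.range fun j : Fin (finrank ℚ (Π i, L i)) => (if (j : ℕ) ≤ 1 then (1 : ℤ) else 2) • a ^ (j : ℕ)),
    isFullLattice_span_smulPow a hfull 1, ?_, span_smulPow_le_span_pow a 1,
    fun k hk => pow_span_smulPow_one_eq_span_pow a (by omega) hmul hk,
    fun k hk1 hk => pow_span_smulPow_one_mul_div_div_ne a hfull hmul hk1 hk,
    fun k hk1 hk => pow_span_smulPow_one_ne_pow_succ a hfull hmul hk1 hk⟩
  have h := pow_mem_span_smulPow_of_le (k := 1) a (⟨0, by omega⟩ : Fin (finrank ℚ (Π i, L i))) (Nat.zero_le _)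
  rwa [pow_zero] at h

end DedekindExample

end Literature.NumberTheory.ComplexMultiplication
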